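import Summits.Ventures.CertifiedManyBodySolver.Downfold.EmeryFermiEnergyExistsAll
import HarnessLib

/-!
# CONTOUR NESTING: a one-variable quadratic criterion puts the energy-`e` Fermi sea of one σ row inside the energy-`e′` Fermi sea of another,
# hence orders the fillings and bounds the Fermi energy of the second row — the device behind SHARP Fermi-energy moduli (INFL-3to1-B §B.88 (a)–(c))

Venture CertifiedManyBodySolver, cell `pub/hubbard-downfold` (stage S1; INFLATION-RULES-3to1-B §B.88), seat hubbard-downfold-mod-4 (technique B = band
level, g36); namespace `Summit.Ventures.CertifiedManyBodySolver.Downfold.Emery`. Everything PROVED (0 sorry, no definition). WHAT THIS IS NOT: a statement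
about any material; `U = 0` one-body kinematics of the σ (d–p_x–p_y + t_pp, t_pp′) model; no number lives here.

The Fermi-energy levers of §B.83/§B.85 bound `ε_F(θ′) − ε_F(θ)` by the SUP-NORM of the band shift over the zone (`1·δΔ`, `4·δt_pp`, `4·δt_pp′`,
the sub-quadratic `t_pd` law). The Fermi energy only sees the band near the Fermi surface: `ε_F(θ′) ≤ e′` as soon as the occupied set of `θ` at
`ε_F(θ)` lies inside the occupied set of `θ′` at `e′` (§3–§4). Since every constant-energy contour of the σ model is BILINEAR in
`(x, y) = (sin²(k_x/2), sin²(k_y/2))` (`charCubic = cA − 4fsD·(x + y) − 16fsN·xy`, `EmeryFermiSurfaceShape`), nesting of two Fermi seas inside the zone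
square is decided by ONE quadratic in `x` on `[0, 1]` (§1–§2):

* §1 `quad_nonneg_on_unitInterval`: `α + βx + γx² ≥ 0` on `[0, 1]` from `α ≥ 0`, `α + β + γ ≥ 0` and one of four elementary side conditions
  (middle Bernstein coefficient, monotone up, monotone down, discriminant).
* §2 `bilinear_nonneg_transfer`: for `f = A − B(x + y) − Cxy`, `g = A′ − B′(x + y) − C′xy` with `B + Cx > 0`, `B′ + C′x > 0`:
  `q(x) = (A′B − AB′) + (A′C − AC′)x + (BC′ − B′C)x² ≥ 0` and `f(x, y) ≥ 0` imply `g(x, y) ≥ 0` (no sign needed on `y`).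
* §3 `charCubic_nonneg_transfer`, `abOccSet_subset_of_transfer`, `abFilling_le_of_transfer`: the contour instance and its measure consequence.
* §4 `fermiEnergyOf_le_of_le_abFilling` (`ν ≤ abFilling θ′ e′`, `e′ ≥ 0` ⇒ `ε_F(θ′; ν) ≤ e′`) and **`fermiEnergyOf_le_of_transfer`**: if the
  Fermi sea of `θ` at its own Fermi energy transfers into the `e′`-sea of `θ′` then `ε_F(θ′; ν) ≤ e′` — used with `θ′ =` anchor / `θ =` member to
  LOWER-bound a member's Fermi energy, and with the roles swapped to UPPER-bound it (`EmeryScaleLeverSteps`).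

Sources: three-band model [HybertsenSchluterChristensen1989, Eq. (1)]; contour form [AndersenEtAl1995, §6]; arithmetic [folklore].
-/

noncomputable section

namespace Summit.Ventures.CertifiedManyBodySolver.Downfold.Emery

open Real Set MeasureTheory

/-! ## §1 A quadratic is non-negative on `[0, 1]` -/

/-- `α + βx + γx² ≥ 0` on `[0, 1]` from the endpoint values `α ≥ 0`, `α + β + γ ≥ 0` and ONE of: the middle Bernstein coefficient `2α + β ≥ 0`;
`β ≥ 0`; `β + 2γ ≤ 0`; `γ ≥ 0 ∧ β² ≤ 4αγ`. [folklore] -/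
theorem quad_nonneg_on_unitInterval {α β γ x : ℝ} (hx : x ∈ Icc (0 : ℝ) 1) (h0 : 0 ≤ α) (h1 : 0 ≤ α + β + γ)
    (hside : 0 ≤ 2 * α + β ∨ 0 ≤ β ∨ β + 2 * γ ≤ 0 ∨ (0 ≤ γ ∧ β ^ 2 ≤ 4 * α * γ)) : 0 ≤ α + β * x + γ * x ^ 2 := by
  obtain ⟨hx0, hx1⟩ := hx
  have h1x : 0 ≤ 1 - x := by linarith
  have hxx : 0 ≤ x * (1 - x) := mul_nonneg hx0 h1x
  rcases hside with hb | hb | hb | ⟨hg, hd⟩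
  · -- Bernstein form: q = α(1−x)² + (2α+β)x(1−x) + (α+β+γ)x²
    have e : α + β * x + γ * x ^ 2 = α * (1 - x) ^ 2 + (2 * α + β) * (x * (1 - x)) + (α + β + γ) * x ^ 2 := by ring
    rw [e]
    positivity
  · -- β ≥ 0: if γ ≥ 0 every term is ≥ 0; if γ < 0 the function is concave: q(x) = (1−x)q(0) + x q(1) + (−γ)x(1−x)
    rcases le_or_gt 0 γ with hg | hg
    · positivity
    · have e : α + β * x + γ * x ^ 2 = (1 - x) * α + x * (α + β + γ) + (-γ) * (x * (1 - x)) := by ring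
      rw [e]
      have : 0 ≤ -γ := by linarith
      positivity
  · -- β + 2γ ≤ 0: decreasing (γ ≥ 0) or concave (γ < 0)
    rcases le_or_gt 0 γ with hg | hg
    · have e : α + β * x + γ * x ^ 2 = (α + β + γ) + (1 - x) * (-(β + 2 * γ)) + γ * (1 - x) ^ 2 := by ring
      rw [e]
      have : 0 ≤ -(β + 2 * γ) := by linarith
      positivity
    · have e : α + β * x + γ * x ^ 2 = (1 - x) * α + x * (α + β + γ) + (-γ) * (x * (1 - x)) := by ring
      rw [e]
      have : 0 ≤ -γ := by linarith
      positivity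
  · -- discriminant: 4γ·q = (2γx + β)² + (4αγ − β²)
    rcases hg.lt_or_eq with hg | hg
    · have e : α + β * x + γ * x ^ 2 = ((2 * γ * x + β) ^ 2 + (4 * α * γ - β ^ 2)) / (4 * γ) := by
        field_simp
        ring
      rw [e]
      apply div_nonneg _ (by linarith)
      nlinarith [sq_nonneg (2 * γ * x + β)]
    · -- γ = 0 ⇒ β = 0
      have hb : β = 0 := by
        rw [← hg] at hd
        have : β ^ 2 ≤ 0 := by simpa using hd
        exact pow_eq_zero_iff (n := 2) (by norm_num) |>.1 (le_antisymm this (sq_nonneg β))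
      rw [← hg, hb]
      simpa using h0

/-! ## §2 Nesting of two bilinear contours in the unit square -/

/-- **BILINEAR NESTING**: `f = A − B(x + y) − Cxy ≥ 0 ⇒ g = A′ − B′(x + y) − C′xy ≥ 0` at every `(x, y)` with `B + Cx > 0`, `B′ + C′x > 0` and
`q(x) = (A′B − AB′) + (A′C − AC′)x + (BC′ − B′C)x² ≥ 0` (the outer contour `y_g(x) = (A′ − B′x)/(B′ + C′x)` lies above the inner one). [folklore] -/
theorem bilinear_nonneg_transfer {A B C A' B' C' x y : ℝ} (hden : 0 < B + C * x) (hden' : 0 < B' + C' * x)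
    (hq : 0 ≤ (A' * B - A * B') + (A' * C - A * C') * x + (B * C' - B' * C) * x ^ 2) (hf : 0 ≤ A - B * (x + y) - C * (x * y)) :
    0 ≤ A' - B' * (x + y) - C' * (x * y) := by
  -- y·(B + Cx) ≤ A − Bx
  have hy : y * (B + C * x) ≤ A - B * x := by nlinarith
  -- (B + Cx)·g = (B + Cx)(A′ − B′x) − y(B + Cx)(B′ + C′x) ≥ (B + Cx)(A′ − B′x) − (A − Bx)(B′ + C′x) = q(x)
  have hkey : (A' * B - A * B') + (A' * C - A * C') * x + (B * C' - B' * C) * x ^ 2 ≤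
      (B + C * x) * (A' - B' * (x + y) - C' * (x * y)) := by
    have e1 : (B + C * x) * (A' - B' * (x + y) - C' * (x * y)) = (B + C * x) * (A' - B' * x) - (y * (B + C * x)) * (B' + C' * x) := by ring
    have e2 : (A' * B - A * B') + (A' * C - A * C') * x + (B * C' - B' * C) * x ^ 2 =
        (B + C * x) * (A' - B' * x) - (A - B * x) * (B' + C' * x) := by
      ring
    rw [e1, e2]
    have := mul_le_mul_of_nonneg_right hy hden'.le
    linarith
  by_contra hneg
  push Not at hneg
  have : (B + C * x) * (A' - B' * (x + y) - C' * (x * y)) < 0 := mul_neg_of_pos_of_neg hden hneg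
  linarith

/-! ## §3 The contour instance: Fermi seas of two σ rows -/

section Contour

variable {Δ a b c e Δ' a' b' c' e' : ℝ}

/-- **CONTOUR TRANSFER**: with `(A, B, C) = (cA, 4fsD, 16fsN)` of row `θ` at energy `e` and `(A′, B′, C′)` of row `θ′` at `e′` (`fsD, fsD′ > 0`,
`fsN, fsN′ ≥ 0`), the quadratic criterion at `x ∈ [0, 1]` gives `charCubic θ (x, y; e) ≥ 0 ⇒ charCubic θ′ (x, y; e′) ≥ 0` (any `y`). [folklore] -/
theorem charCubic_nonneg_transfer {x y : ℝ} (hx : x ∈ Icc (0 : ℝ) 1) (hD : 0 < fsD Δ a c e) (hN : 0 ≤ fsN a b c e) (hD' : 0 < fsD Δ' a' c' e')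
    (hN' : 0 ≤ fsN a' b' c' e')
    (hq : 0 ≤ (cA Δ' e' * (4 * fsD Δ a c e) - cA Δ e * (4 * fsD Δ' a' c' e')) +
      (cA Δ' e' * (16 * fsN a b c e) - cA Δ e * (16 * fsN a' b' c' e')) * x +
      ((4 * fsD Δ a c e) * (16 * fsN a' b' c' e') - (4 * fsD Δ' a' c' e') * (16 * fsN a b c e)) * x ^ 2)
    (hf : 0 ≤ charCubic Δ a b c x y e) : 0 ≤ charCubic Δ' a' b' c' x y e' := by
  rw [charCubic_bilinear] at hf ⊢
  have hx0 := hx.1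
  have hden : 0 < 4 * fsD Δ a c e + 16 * fsN a b c e * x := by
    have : 0 ≤ 16 * fsN a b c e * x := by positivity
    linarith
  have hden' : 0 < 4 * fsD Δ' a' c' e' + 16 * fsN a' b' c' e' * x := by
    have : 0 ≤ 16 * fsN a' b' c' e' * x := by positivity
    linarith
  exact bilinear_nonneg_transfer hden hden' hq hf

/-- **FERMI-SEA NESTING**: under the contour-transfer hypothesis at every `(x, y) ∈ [0, 1]²` and `e, e′ > 0`, the occupied set of `θ` at `e` lies in
the occupied set of `θ′` at `e′` (`Δ, Δ′, t_pp, t_pp′, … ≥ 0` for the sign characterisation of the antibonding band). [folklore] -/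
theorem abOccSet_subset_of_transfer (hΔ : 0 ≤ Δ) (hc : 0 ≤ c) (hb : 0 ≤ b) (hΔ' : 0 ≤ Δ') (hc' : 0 ≤ c') (hb' : 0 ≤ b') (he : 0 < e)
    (he' : 0 < e')
    (h : ∀ x y : ℝ, x ∈ Icc (0 : ℝ) 1 → y ∈ Icc (0 : ℝ) 1 → 0 ≤ charCubic Δ a b c x y e → 0 ≤ charCubic Δ' a' b' c' x y e') :
    abOccSet Δ a b c e ⊆ abOccSet Δ' a' b' c' e' := by
  intro k hk
  refine ⟨hk.1, ?_⟩
  have hx : halfSq k.1 ∈ Icc (0 : ℝ) 1 := ⟨halfSq_nonneg _, halfSq_le_one _⟩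
  have hy : halfSq k.2 ∈ Icc (0 : ℝ) 1 := ⟨halfSq_nonneg _, halfSq_le_one _⟩
  have hle : abBand Δ a b c (halfSq k.1) (halfSq k.2) ≤ e := hk.2
  have hf : 0 ≤ charCubic Δ a b c (halfSq k.1) (halfSq k.2) e := by
    by_contra hneg
    push Not at hneg
    have := (charCubic_neg_iff_lt_abBand hΔ hc hb hx.1 hy.1 he).1 hneg
    linarith
  have hg := h _ _ hx hy hf
  show abBand Δ' a' b' c' (halfSq k.1) (halfSq k.2) ≤ e'
  by_contra hgt
  push Not at hgt
  have := (charCubic_neg_iff_lt_abBand hΔ' hc' hb' hx.1 hy.1 he').2 hgt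
  linarith

/-- **FILLING ORDER FROM NESTING**: under the same hypotheses `abFilling θ e ≤ abFilling θ′ e′`. [folklore] -/
theorem abFilling_le_of_transfer (hΔ : 0 ≤ Δ) (hc : 0 ≤ c) (hb : 0 ≤ b) (hΔ' : 0 ≤ Δ') (hc' : 0 ≤ c') (hb' : 0 ≤ b') (he : 0 < e)
    (he' : 0 < e')
    (h : ∀ x y : ℝ, x ∈ Icc (0 : ℝ) 1 → y ∈ Icc (0 : ℝ) 1 → 0 ≤ charCubic Δ a b c x y e → 0 ≤ charCubic Δ' a' b' c' x y e') :
    abFilling Δ a b c e ≤ abFilling Δ' a' b' c' e' := by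
  unfold abFilling
  refine div_le_div_of_nonneg_right ?_ (by positivity)
  exact ENNReal.toReal_mono (volume_abOccSet_ne_top _ _ _ _ _) (measure_mono (abOccSet_subset_of_transfer hΔ hc hb hΔ' hc' hb' he he' h))

end Contour

/-! ## §4 Fermi-energy bounds from nesting -/

section Fermi

variable {Δ a b c Δ' a' b' c' ν e' : ℝ}

/-- `ν ≤ abFilling θ′ e′` with `e′ ≥ 0` ⇒ `ε_F(θ′; ν) ≤ e′` (the Fermi energy is the least such energy). [folklore] -/
theorem fermiEnergyOf_le_of_le_abFilling (he' : 0 ≤ e') (h : ν ≤ abFilling Δ' a' b' c' e') : fermiEnergyOf Δ' a' b' c' ν ≤ e' := by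
  unfold fermiEnergyOf
  exact csInf_le ⟨0, fun x hx => hx.1⟩ ⟨he', h⟩

/-- **FERMI-ENERGY BOUND FROM CONTOUR TRANSFER**: rows `θ = (Δ, a, b, c)`, `θ′ = (Δ′, a′, b′, c′)` on the physical region, `0 < ν < 1`, `e′ > 0`;
if the Fermi sea of `θ` AT ITS OWN FERMI ENERGY transfers into the `e′`-sea of `θ′` (quadratic criterion pointwise on `[0, 1]²`), then
**`ε_F(θ′; ν) ≤ e′`**. [folklore] -/
theorem fermiEnergyOf_le_of_transfer (hΔ : 0 < Δ) (ha : a ≠ 0) (hc : 0 ≤ c) (hb : 0 ≤ b) (hΔ' : 0 ≤ Δ') (hc' : 0 ≤ c') (hb' : 0 ≤ b')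
    (hν0 : 0 < ν) (hν1 : ν < 1) (he' : 0 < e')
    (h : ∀ x y : ℝ, x ∈ Icc (0 : ℝ) 1 → y ∈ Icc (0 : ℝ) 1 → 0 ≤ charCubic Δ a b c x y (fermiEnergyOf Δ a b c ν) →
      0 ≤ charCubic Δ' a' b' c' x y e') :
    fermiEnergyOf Δ' a' b' c' ν ≤ e' := by
  have hfill : abFilling Δ a b c (fermiEnergyOf Δ a b c ν) = ν := abFilling_fermiEnergyOf' hΔ ha hc hb hν0 hν1
  have hpos : 0 < fermiEnergyOf Δ a b c ν := fermiEnergyOf_pos hΔ ha hc hb hν0 hν1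
  have hle := abFilling_le_of_transfer hΔ.le hc hb hΔ' hc' hb' hpos he' h
  rw [hfill] at hle
  exact fermiEnergyOf_le_of_le_abFilling he'.le hle

end Fermi

end Summit.Ventures.CertifiedManyBodySolver.Downfold.Emery
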